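import Summits.Ventures.CertifiedArithmetic.LowPrec.SRRecursionLimitedBits
import HarnessLib

/-!
# Affine recursions under LIMITED-RANDOMNESS stochastic rounding, II — second moments

HONEST FRAMING: certified error envelopes and provably optimal rounding/accumulation schemes for
low-precision formats under stated cost models; every table by two implementations; no hardware or
vendor claims.

Setting of file LXXIII (`SRRecursionLimitedBits`): `x₀ = s`, `xₖ₊₁ = round_q(a k · xₖ + b k)` into a finite
value set `F`, the rounding going AWAY from zero with probability `q(θ)`, `q([0,1]) ⊆ [0,1]`,
`|q θ − θ| ≤ ε`; `mₙ` the exact trajectory, `A_{k+1} = ∏_{j>k} a j` the downstream gains,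
`sqGainSum = ∑ A_{k+1}²` (file XLVII), `absGainSum = ∑ |A_{k+1}|` (file LXXIII). Hypotheses throughout: no
branch saturates (`NoSatR`), candidate gaps `≤ G` on every branch (`GapLER`). Here, the second moment —
the recursion analogue of file LXI (`SRLimitedBitsMSEGeneral`, sums):

1. `recExpD` — the outcome tree with a second register carrying the GAIN-WEIGHTED accumulated conditional
   bias (predictable drift) `D = ∑ₖ A_{k+1} βₖ`, `βₖ = E[xₖ₊₁ | xₖ] − (a k xₖ + b k)`;
   `recExpD_eq_recExpQ`: functionals of the final value alone have the file-LXXIII expectation.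
2. `recExpD_mart_mean`, `recExpD_mart_sq_le`: the martingale part `M = xₙ − mₙ − D` has `E M = 0` and
   `E M² ≤ (∑ A_{k+1}²)·G²/4` (two-point conditional variances `π(1−π)gap² ≤ G²/4`, each propagated by its
   squared downstream gain, orthogonal increments); `recExpD_mono_reach`: on every branch
   `|D| ≤ (∑ |A_{k+1}|)·ε·G`.
3. **`recExpQ_sq_le_general` — THE MEAN-SQUARE LAW**: for every `r > 0`,
   `E(xₙ − mₙ)² ≤ (1+r)·(∑A²)·G²/4 + (1+r⁻¹)·((∑|A|)·ε·G)²`; over `ℝ` (`recExpQ_sq_le_rms`) the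
   **RMS TRIANGLE LAW** `RMS(xₙ − mₙ) ≤ √(∑A²)·G/2 + (∑|A|)·ε·G` — noise budget with the ℓ² gain norm,
   drift budget with the ℓ¹ gain norm; `recExpQ_sq_le_of_exact`: `ε = 0` gives `(∑A²)·G²/4` (file XLVII's
   `recVar_le_window`, now for every `q` that is exact on the probabilities met).
4. Instances `srEps_rec_sq_le_general`, `stochasticA/B/C_rec_sq_le_general` (P3109, `N` bits).

Sums (`a ≡ 1`) recover file LXI verbatim (`∑A² = ∑|A| = n`). Contractions `|a k| ≤ β < 1`: both budgets
are bounded UNIFORMLY IN TIME (`∑A² ≤ 1/(1−β²)`, `∑|A| ≤ 1/(1−β)`): `RMS ≤ G/(2√(1−β²)) + εG/(1−β)`.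
Horner / FMA-Horner and FP4 kernel witnesses: file LXXV.

Placement. [ElararEtAl2025] (El Arar–Fasi–Filip–Mikaitis 2026, arXiv:2603.24161, Thm. 1–2) give
first-order probabilistic bounds for Horner and pairwise summation under `SR_{p,r}` via a martingale +
bias split in the `(1+δ)` model; the statements here are exact second-moment inequalities in a finite
format for every admissible `q`. Sharp cross terms are NOT claimed (cf. file LX's witness across zero).
-/

namespace Summit.Ventures.CertifiedArithmetic.LowPrec.SR

open Literature.ComputerArithmetic.ConnollyHighamMary2021
open Finset

variable {K : Type*} [Field K] [LinearOrder K] [IsStrictOrderedRing K]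

namespace LimitedBits

/-! ### The two-register tree -/

/-- **Two-register outcome tree for affine recursions**: `E f(xₙ, D₀ + ∑ₖ A_{k+1} βₖ)` — the test function
sees the final value and the gain-weighted accumulated conditional bias along the branch. -/
def recExpD (F : Finset K) (q : K → K) : (ℕ → K) → (ℕ → K) → ℕ → (K → K → K) → K → K → K
  | _, _, 0, f, s, D => f s D
  | a, b, n + 1, f, s, D => stepQ F q (a 0 * s + b 0)
      (fun t => recExpD F q (fun i => a (i + 1)) (fun i => b (i + 1)) n f t
        (D + affGain (fun i => a (i + 1)) n * biasQ F q (a 0 * s + b 0)))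

omit [IsStrictOrderedRing K] in
/-- Functionals of the final value alone: `recExpD` agrees with `recExpQ` (file LXXIII). -/
theorem recExpD_eq_recExpQ (F : Finset K) (q : K → K) (g : K → K) :
    ∀ (a b : ℕ → K) (n : ℕ) (s D : K),
      recExpD F q a b n (fun t _ => g t) s D = recExpQ F q (affMap a b) n g s := by
  intro a b n
  induction n generalizing a b with
  | zero => intro s D; rfl
  | succ n ih =>
    intro s D
    simp only [recExpD, recExpQ, affMap_succ, affMap_apply]
    congr 1; funext t; exact ih _ _ t _

omit [IsStrictOrderedRing K] in
/-- Linearity of the two-register expectation. -/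
theorem recExpD_lin (F : Finset K) (q : K → K) :
    ∀ (a b : ℕ → K) (n : ℕ) (u v : K) (f h : K → K → K) (s D : K),
      recExpD F q a b n (fun t D => u * f t D + v * h t D) s D
        = u * recExpD F q a b n f s D + v * recExpD F q a b n h s D := by
  intro a b n
  induction n generalizing a b with
  | zero => intro u v f h s D; rfl
  | succ n ih =>
    intro u v f h s D
    simp only [recExpD]
    set D' := D + affGain (fun i => a (i + 1)) n * biasQ F q (a 0 * s + b 0)
    have : (fun t => recExpD F q (fun i => a (i + 1)) (fun i => b (i + 1)) n
        (fun t D => u * f t D + v * h t D) t D') = fun t =>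
        u * recExpD F q (fun i => a (i + 1)) (fun i => b (i + 1)) n f t D'
          + v * recExpD F q (fun i => a (i + 1)) (fun i => b (i + 1)) n h t D' :=
      funext fun t => ih _ _ u v f h t _
    rw [this]; unfold stepQ; ring

omit [IsStrictOrderedRing K] in
/-- `E[1] = 1` on the two-register tree. -/
theorem recExpD_one (F : Finset K) (q : K → K) (a b : ℕ → K) (n : ℕ) (s D : K) :
    recExpD F q a b n (fun _ _ => (1 : K)) s D = 1 := by
  rw [recExpD_eq_recExpQ, recExpQ_const]

/-- **Monotonicity on reachable branches**: along every branch the drift register moves by at most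
`(∑ₖ |A_{k+1}|)·ε·G` (`|A_{k+1} βₖ| ≤ |A_{k+1}|·ε·gapₖ`), so a pointwise inequality on that range integrates. -/
theorem recExpD_mono_reach (F : Finset K) {q : K → K} {ε G : K}
    (hq01 : ∀ η, 0 ≤ η → η ≤ 1 → 0 ≤ q η ∧ q η ≤ 1) (hq : ∀ η, 0 ≤ η → η ≤ 1 → |q η - η| ≤ ε) :
    ∀ (a b : ℕ → K) (n : ℕ) (f h : K → K → K) (s D : K), NoSatR F (affMap a b) n s →
      GapLER F G (affMap a b) n s →
      (∀ t D', |D' - D| ≤ absGainSum a n * (ε * G) → f t D' ≤ h t D') →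
        recExpD F q a b n f s D ≤ recExpD F q a b n h s D := by
  have hε : 0 ≤ ε := (abs_nonneg _).trans (hq 0 le_rfl zero_le_one)
  intro a b n
  induction n generalizing a b with
  | zero =>
    intro f h s D _ _ hfh
    exact hfh s D (by simp [absGainSum])
  | succ n ih =>
    rintro f h s D ⟨hin, hnu, hnd⟩ ⟨hg, hgu, hgd⟩ hfh
    simp only [affMap_succ, affMap_apply] at hin hnu hnd hg hgu hgd
    simp only [recExpD]
    set c := a 0 * s + b 0
    set A₁ := affGain (fun i => a (i + 1)) n
    have hg' : up F c - dn F c ≤ G := hg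
    have hβ : |A₁ * biasQ F q c| ≤ |A₁| * (ε * G) := by
      rw [abs_mul]
      exact mul_le_mul_of_nonneg_left
        ((abs_stepQ_id_sub_le F hq c).trans (mul_le_mul_of_nonneg_left hg' hε)) (abs_nonneg _)
    have hreach : ∀ t D', |D' - (D + A₁ * biasQ F q c)| ≤ absGainSum (fun i => a (i + 1)) n * (ε * G) →
        f t D' ≤ h t D' := by
      intro t D' hD'
      refine hfh t D' ?_
      have htri : |D' - D| ≤ |D' - (D + A₁ * biasQ F q c)| + |A₁ * biasQ F q c| := by
        have := abs_add_le (D' - (D + A₁ * biasQ F q c)) (A₁ * biasQ F q c)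
        rwa [show D' - (D + A₁ * biasQ F q c) + A₁ * biasQ F q c = D' - D by ring] at this
      have : absGainSum a (n + 1) * (ε * G) = |A₁| * (ε * G)
          + absGainSum (fun i => a (i + 1)) n * (ε * G) := by
        simp only [absGainSum]; ring
      linarith
    exact stepQ_mono_leaves F hq01 c
      (ih _ _ f h (up F c) _ hnu hgu hreach) (ih _ _ f h (dn F c) _ hnd hgd hreach)

omit [IsStrictOrderedRing K] in
/-- **The martingale part has mean zero**: `E[xₙ − D] = mₙ − D₀` (no saturation). -/
theorem recExpD_mart_mean (F : Finset K) (q : K → K) :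
    ∀ (a b : ℕ → K) (n : ℕ) (s D : K), NoSatR F (affMap a b) n s →
      recExpD F q a b n (fun t D' => t - D') s D = affMean a b n s - D := by
  intro a b n
  induction n generalizing a b with
  | zero => intro s D _; simp [recExpD, affMean]
  | succ n ih =>
    rintro s D ⟨hin, hnu, hnd⟩
    simp only [affMap_succ, affMap_apply] at hin hnu hnd
    simp only [recExpD, affMean]
    set c := a 0 * s + b 0
    simp only [stepQ]
    rw [ih _ _ _ _ hnu, ih _ _ _ _ hnd, affMean_eq (fun i => a (i + 1)) (fun i => b (i + 1)) n (up F c),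
      affMean_eq (fun i => a (i + 1)) (fun i => b (i + 1)) n (dn F c),
      affMean_eq (fun i => a (i + 1)) (fun i => b (i + 1)) n c]
    unfold biasQ; simp only [stepQ]; rw [clamp_eq_self hin]; ring

omit [IsStrictOrderedRing K] in
/-- Re-centring the squared martingale functional (linearity). -/
theorem recExpD_sq_shift (F : Finset K) (q : K → K) (a b : ℕ → K) (n : ℕ) (t D₁ α α' : K) :
    recExpD F q a b n (fun y D' => (y - D' - α) ^ 2) t D₁
      = recExpD F q a b n (fun y D' => (y - D' - α') ^ 2) t D₁
        - 2 * (α - α') * (recExpD F q a b n (fun y D' => y - D') t D₁ - α') + (α - α') ^ 2 := by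
  have h1 : (fun y D' : K => (y - D' - α) ^ 2) = fun y D' =>
      1 * (y - D' - α') ^ 2
        + 1 * ((-2 * (α - α')) * (y - D') + ((α - α') ^ 2 + 2 * (α - α') * α') * 1) := by
    funext y D'; ring
  rw [h1, recExpD_lin, recExpD_lin, recExpD_one]; ring

/-- **The martingale part has second moment `≤ (∑ A_{k+1}²)·G²/4`**: the two-point conditional variances
`π(1−π)·gap² ≤ G²/4`, each multiplied by its squared downstream gain, add up (orthogonal increments). -/
theorem recExpD_mart_sq_le (F : Finset K) {q : K → K} {G : K}
    (hq01 : ∀ η, 0 ≤ η → η ≤ 1 → 0 ≤ q η ∧ q η ≤ 1) :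
    ∀ (a b : ℕ → K) (n : ℕ) (s D α : K), NoSatR F (affMap a b) n s → GapLER F G (affMap a b) n s →
      α = affMean a b n s - D →
        recExpD F q a b n (fun y D' => (y - D' - α) ^ 2) s D ≤ sqGainSum a n * (G ^ 2 / 4) := by
  intro a b n
  induction n generalizing a b with
  | zero => intro s D α _ _ hα; simp [recExpD, sqGainSum, affMean, hα]
  | succ n ih =>
    rintro s D α ⟨hin, hnu, hnd⟩ ⟨hg, hgu, hgd⟩ hα
    simp only [affMap_succ, affMap_apply] at hin hnu hnd hg hgu hgd
    simp only [affMean] at hα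
    simp only [recExpD, sqGainSum]
    set c := a 0 * s + b 0 with hc
    set a' : ℕ → K := fun i => a (i + 1) with ha'
    set b' : ℕ → K := fun i => b (i + 1) with hb'
    set A₁ := affGain a' n with hA₁
    set β := biasQ F q c with hβ
    set m₀ := affMean a' b' n 0 with hm₀
    have hg' : up F c - dn F c ≤ G := hg
    have hg0 : 0 ≤ up F c - dn F c := sub_nonneg.mpr (dn_le_up F _)
    have hβ' : β = pUpQ F q c * up F c + (1 - pUpQ F q c) * dn F c - c := by
      rw [hβ]; unfold biasQ; simp only [stepQ]; rw [clamp_eq_self hin]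
    have hα' : α = A₁ * c + m₀ - D := by rw [hα, affMean_eq]
    have hmu : affMean a' b' n (up F c) = A₁ * up F c + m₀ := by rw [affMean_eq]
    have hmd : affMean a' b' n (dn F c) = A₁ * dn F c + m₀ := by rw [affMean_eq]
    have hVu := ih a' b' (up F c) (D + A₁ * β) (A₁ * up F c + m₀ - (D + A₁ * β)) hnu hgu (by rw [hmu])
    have hVd := ih a' b' (dn F c) (D + A₁ * β) (A₁ * dn F c + m₀ - (D + A₁ * β)) hnd hgd (by rw [hmd])
    simp only [stepQ]
    rw [recExpD_sq_shift F q a' b' n (up F c) (D + A₁ * β) α (A₁ * up F c + m₀ - (D + A₁ * β)),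
      recExpD_sq_shift F q a' b' n (dn F c) (D + A₁ * β) α (A₁ * dn F c + m₀ - (D + A₁ * β)),
      recExpD_mart_mean F q a' b' n (up F c) (D + A₁ * β) hnu,
      recExpD_mart_mean F q a' b' n (dn F c) (D + A₁ * β) hnd, hmu, hmd]
    obtain ⟨hp0, hp1⟩ := pUpQ_mem F hq01 c
    have h14 : pUpQ F q c * (1 - pUpQ F q c) ≤ 1 / 4 := by nlinarith [sq_nonneg (2 * pUpQ F q c - 1)]
    have hG2 : (up F c - dn F c) ^ 2 ≤ G ^ 2 := pow_le_pow_left₀ hg0 hg' 2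
    have hvar' : pUpQ F q c * (1 - pUpQ F q c) * (up F c - dn F c) ^ 2 ≤ 1 / 4 * G ^ 2 :=
      mul_le_mul h14 hG2 (sq_nonneg _) (by norm_num)
    have h3 := mul_le_mul_of_nonneg_left hvar' (sq_nonneg A₁)
    have hvar : pUpQ F q c * (α - (A₁ * up F c + m₀ - (D + A₁ * β))) ^ 2
        + (1 - pUpQ F q c) * (α - (A₁ * dn F c + m₀ - (D + A₁ * β))) ^ 2
        = A₁ ^ 2 * (pUpQ F q c * (1 - pUpQ F q c) * (up F c - dn F c) ^ 2) := by
      rw [hα', hβ']; ring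
    rw [← hvar] at h3
    set π := pUpQ F q c
    set Vu := recExpD F q a' b' n (fun y D' => (y - D' - (A₁ * up F c + m₀ - (D + A₁ * β))) ^ 2)
      (up F c) (D + A₁ * β)
    set Vd := recExpD F q a' b' n (fun y D' => (y - D' - (A₁ * dn F c + m₀ - (D + A₁ * β))) ^ 2)
      (dn F c) (D + A₁ * β)
    clear_value π Vu Vd A₁ β m₀
    have a1 := mul_le_mul_of_nonneg_left hVu hp0
    have a2 := mul_le_mul_of_nonneg_left hVd (sub_nonneg.mpr hp1)
    have hexp : π * (Vu - 2 * (α - (A₁ * up F c + m₀ - (D + A₁ * β)))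
          * (A₁ * up F c + m₀ - (D + A₁ * β) - (A₁ * up F c + m₀ - (D + A₁ * β)))
          + (α - (A₁ * up F c + m₀ - (D + A₁ * β))) ^ 2)
        + (1 - π) * (Vd - 2 * (α - (A₁ * dn F c + m₀ - (D + A₁ * β)))
          * (A₁ * dn F c + m₀ - (D + A₁ * β) - (A₁ * dn F c + m₀ - (D + A₁ * β)))
          + (α - (A₁ * dn F c + m₀ - (D + A₁ * β))) ^ 2)
        = (π * Vu + (1 - π) * Vd) + (π * (α - (A₁ * up F c + m₀ - (D + A₁ * β))) ^ 2
          + (1 - π) * (α - (A₁ * dn F c + m₀ - (D + A₁ * β))) ^ 2) := by ring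
    rw [hexp]
    have hfin : sqGainSum a' n * (G ^ 2 / 4) + A₁ ^ 2 * (1 / 4 * G ^ 2)
        = (A₁ ^ 2 + sqGainSum a' n) * (G ^ 2 / 4) := by ring
    linarith

/-- **General mean-square law for affine recursions under limited-randomness SR**: no saturating branch,
candidate gaps `≤ G` on every branch; for every `r > 0`,
`E(xₙ − mₙ)² ≤ (1 + r)·(∑A_{k+1}²)·G²/4 + (1 + r⁻¹)·((∑|A_{k+1}|)·ε·G)²`
(pathwise `(M + D)² ≤ (1+r)M² + (1+r⁻¹)D²`; over `ℝ`: `RMS ≤ √(∑A²)·G/2 + (∑|A|)·εG`, `recExpQ_sq_le_rms`). -/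
theorem recExpQ_sq_le_general (F : Finset K) {q : K → K} {ε G : K}
    (hq01 : ∀ η, 0 ≤ η → η ≤ 1 → 0 ≤ q η ∧ q η ≤ 1) (hq : ∀ η, 0 ≤ η → η ≤ 1 → |q η - η| ≤ ε)
    (a b : ℕ → K) (n : ℕ) (s : K) (hns : NoSatR F (affMap a b) n s)
    (hgap : GapLER F G (affMap a b) n s) {r : K} (hr : 0 < r) :
    recExpQ F q (affMap a b) n (fun t => (t - affMean a b n s) ^ 2) s
      ≤ (1 + r) * (sqGainSum a n * (G ^ 2 / 4)) + (1 + r⁻¹) * (absGainSum a n * (ε * G)) ^ 2 := by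
  set m := affMean a b n s with hm
  rw [← recExpD_eq_recExpQ F q (fun t => (t - m) ^ 2) a b n s 0]
  have hpt : ∀ t D', |D' - 0| ≤ absGainSum a n * (ε * G) →
      (fun t D' => (t - m) ^ 2) t D'
        ≤ (fun t D' => (1 + r) * (t - D' - (m - 0)) ^ 2
          + ((1 + r⁻¹) * (absGainSum a n * (ε * G)) ^ 2) * 1) t D' := by
    intro t D' hD
    rw [sub_zero] at hD
    have hD2 : D' ^ 2 ≤ (absGainSum a n * (ε * G)) ^ 2 := by
      have := abs_le.mp hD
      nlinarith [this.1, this.2, abs_nonneg D', hD]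
    have hy := sq_add_le_young hr (t - D' - (m - 0)) D'
    have h1r : 0 ≤ 1 + r⁻¹ := by positivity
    show (t - m) ^ 2 ≤ (1 + r) * (t - D' - (m - 0)) ^ 2 + ((1 + r⁻¹) * (absGainSum a n * (ε * G)) ^ 2) * 1
    rw [show t - m = (t - D' - (m - 0)) + D' by ring]
    nlinarith [mul_le_mul_of_nonneg_left hD2 h1r]
  refine (recExpD_mono_reach F hq01 hq a b n _ _ s 0 hns hgap hpt).trans ?_
  rw [recExpD_lin, recExpD_one]
  have hV := recExpD_mart_sq_le F hq01 a b n s 0 (m - 0) hns hgap (by rw [hm])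
  have h1r : 0 ≤ 1 + r := by positivity
  nlinarith [mul_le_mul_of_nonneg_left hV h1r]

/-- **Rules exact on `[0,1]` up to `ε = 0`** (exact SR; dyadic instances of the P3109 rules): the drift
register never moves, so `E(xₙ − mₙ)² ≤ (∑A_{k+1}²)·G²/4` on any window, with no cross term. -/
theorem recExpQ_sq_le_of_exact (F : Finset K) {q : K → K} {G : K}
    (hq01 : ∀ η, 0 ≤ η → η ≤ 1 → 0 ≤ q η ∧ q η ≤ 1) (hq : ∀ η, 0 ≤ η → η ≤ 1 → |q η - η| ≤ 0)
    (a b : ℕ → K) (n : ℕ) (s : K) (hns : NoSatR F (affMap a b) n s)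
    (hgap : GapLER F G (affMap a b) n s) :
    recExpQ F q (affMap a b) n (fun t => (t - affMean a b n s) ^ 2) s ≤ sqGainSum a n * (G ^ 2 / 4) := by
  set m := affMean a b n s with hm
  rw [← recExpD_eq_recExpQ F q (fun t => (t - m) ^ 2) a b n s 0]
  have hpt : ∀ t D', |D' - 0| ≤ absGainSum a n * (0 * G) →
      (fun t D' => (t - m) ^ 2) t D' ≤ (fun t D' => (t - D' - (m - 0)) ^ 2) t D' := by
    intro t D' hD
    have hD0 : D' = 0 := by simpa using hD
    show (t - m) ^ 2 ≤ (t - D' - (m - 0)) ^ 2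
    rw [hD0]; simp
  exact (recExpD_mono_reach F hq01 hq a b n _ _ s 0 hns hgap hpt).trans
    (recExpD_mart_sq_le F hq01 a b n s 0 (m - 0) hns hgap (by rw [hm]))

end LimitedBits

/-- The variance weight is nonnegative. -/
theorem sqGainSum_nonneg (a : ℕ → K) (n : ℕ) : 0 ≤ sqGainSum a n := by
  induction n generalizing a with
  | zero => simp [sqGainSum]
  | succ n ih => simp only [sqGainSum]; exact add_nonneg (sq_nonneg _) (ih _)

/-! ### Instances: `SR_ε`, P3109 StochasticA/B/C -/

/-- `SR_ε` of [XiaEtAl2022]: `E(xₙ − mₙ)² ≤ (1+r)·(∑A²)·G²/4 + (1+r⁻¹)·((∑|A|)·εG)²`. -/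
theorem srEps_rec_sq_le_general (F : Finset K) {ε G : K} (hε : 0 ≤ ε) (a b : ℕ → K) (n : ℕ) (s : K)
    (hns : NoSatR F (affMap a b) n s) (hgap : GapLER F G (affMap a b) n s) {r : K} (hr : 0 < r) :
    LimitedBits.recExpQ F (qAway ε) (affMap a b) n (fun t => (t - affMean a b n s) ^ 2) s
      ≤ (1 + r) * (sqGainSum a n * (G ^ 2 / 4))
        + (1 + r⁻¹) * (LimitedBits.absGainSum a n * (ε * G)) ^ 2 :=
  LimitedBits.recExpQ_sq_le_general F (qAway_mem hε) (qAway_dev hε) a b n s hns hgap hr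

section P3109
variable [FloorRing K]

/-- **P3109 StochasticA, `N` bits**: drift budget `(∑|A|)·2^{-N}·G`. -/
theorem stochasticA_rec_sq_le_general (F : Finset K) (N : ℕ) {G : K} (a b : ℕ → K) (n : ℕ) (s : K)
    (hns : NoSatR F (affMap a b) n s) (hgap : GapLER F G (affMap a b) n s) {r : K} (hr : 0 < r) :
    LimitedBits.recExpQ F (LimitedBits.probAwayA N) (affMap a b) n (fun t => (t - affMean a b n s) ^ 2) s
      ≤ (1 + r) * (sqGainSum a n * (G ^ 2 / 4))
        + (1 + r⁻¹) * (LimitedBits.absGainSum a n * (1 / 2 ^ N * G)) ^ 2 :=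
  LimitedBits.recExpQ_sq_le_general F (LimitedBits.probAwayA_mem N)
    (fun η _ _ => LimitedBits.abs_probAwayA_sub_le N η) a b n s hns hgap hr

/-- **P3109 StochasticB, `N` bits**: drift budget `(∑|A|)·2^{-(N+1)}·G`. -/
theorem stochasticB_rec_sq_le_general (F : Finset K) (N : ℕ) {G : K} (a b : ℕ → K) (n : ℕ) (s : K)
    (hns : NoSatR F (affMap a b) n s) (hgap : GapLER F G (affMap a b) n s) {r : K} (hr : 0 < r) :
    LimitedBits.recExpQ F (LimitedBits.probAwayB N) (affMap a b) n (fun t => (t - affMean a b n s) ^ 2) s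
      ≤ (1 + r) * (sqGainSum a n * (G ^ 2 / 4))
        + (1 + r⁻¹) * (LimitedBits.absGainSum a n * (1 / 2 ^ (N + 1) * G)) ^ 2 :=
  LimitedBits.recExpQ_sq_le_general F (LimitedBits.probAwayB_mem N)
    (fun η _ _ => LimitedBits.abs_probAwayB_sub_le N η) a b n s hns hgap hr

/-- **P3109 StochasticC, `N` bits**: drift budget `(∑|A|)·2^{-(N+1)}·G`. -/
theorem stochasticC_rec_sq_le_general (F : Finset K) (N : ℕ) {G : K} (a b : ℕ → K) (n : ℕ) (s : K)
    (hns : NoSatR F (affMap a b) n s) (hgap : GapLER F G (affMap a b) n s) {r : K} (hr : 0 < r) :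
    LimitedBits.recExpQ F (LimitedBits.probAwayC N) (affMap a b) n (fun t => (t - affMean a b n s) ^ 2) s
      ≤ (1 + r) * (sqGainSum a n * (G ^ 2 / 4))
        + (1 + r⁻¹) * (LimitedBits.absGainSum a n * (1 / 2 ^ (N + 1) * G)) ^ 2 :=
  LimitedBits.recExpQ_sq_le_general F (LimitedBits.probAwayC_mem N)
    (fun η _ _ => LimitedBits.abs_probAwayC_sub_le N η) a b n s hns hgap hr

end P3109

/-! ### The RMS triangle law over `ℝ` -/

/-- From the Young family `E ≤ (1+r)A² + (1+r⁻¹)B²` for all `r > 0` to `E ≤ (A + B)²`. -/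
theorem LimitedBits.le_sq_add_of_forall_young {E A B : ℝ} (hA : 0 ≤ A) (hB : 0 ≤ B)
    (h : ∀ r : ℝ, 0 < r → E ≤ (1 + r) * A ^ 2 + (1 + r⁻¹) * B ^ 2) : E ≤ (A + B) ^ 2 := by
  refine le_of_forall_pos_le_add fun δ hδ => ?_
  rcases hA.eq_or_lt with hA0 | hApos
  · rcases hB.eq_or_lt with hB0 | hBpos
    · have h1 := h 1 one_pos
      rw [← hA0, ← hB0] at h1 ⊢
      norm_num at h1 ⊢; linarith
    · have h1 := h (B ^ 2 / δ) (by positivity)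
      rw [← hA0] at h1 ⊢
      have hr : (1 + (B ^ 2 / δ)⁻¹) * B ^ 2 = B ^ 2 + δ := by
        rw [inv_div, add_mul, one_mul, div_mul_cancel₀ δ (pow_ne_zero 2 hBpos.ne')]
      rw [hr] at h1
      nlinarith [h1]
  · rcases hB.eq_or_lt with hB0 | hBpos
    · have h1 := h (δ / A ^ 2) (by positivity)
      rw [← hB0] at h1 ⊢
      have hr : (1 + δ / A ^ 2) * A ^ 2 = A ^ 2 + δ := by
        rw [add_mul, one_mul, div_mul_cancel₀ δ (pow_ne_zero 2 hApos.ne')]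
      rw [hr] at h1
      nlinarith [h1]
    · have h1 := h (B / A) (by positivity)
      have hA' : A ≠ 0 := hApos.ne'
      have hB' : B ≠ 0 := hBpos.ne'
      have hr : (1 + B / A) * A ^ 2 + (1 + (B / A)⁻¹) * B ^ 2 = (A + B) ^ 2 := by
        rw [inv_div]; field_simp; ring
      linarith

/-- **RMS triangle law for affine recursions** over `ℝ`:
`E(xₙ − mₙ)² ≤ (√(∑A_{k+1}²)·G/2 + (∑|A_{k+1}|)·ε·G)²` — noise budget (ℓ² gain norm) plus drift budget
(ℓ¹ gain norm), for every admissible `q`, any window and sign pattern. -/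
theorem LimitedBits.recExpQ_sq_le_rms (F : Finset ℝ) {q : ℝ → ℝ} {ε G : ℝ}
    (hq01 : ∀ η, 0 ≤ η → η ≤ 1 → 0 ≤ q η ∧ q η ≤ 1) (hq : ∀ η, 0 ≤ η → η ≤ 1 → |q η - η| ≤ ε)
    (hG : 0 ≤ G) (a b : ℕ → ℝ) (n : ℕ) (s : ℝ) (hns : NoSatR F (affMap a b) n s)
    (hgap : GapLER F G (affMap a b) n s) :
    LimitedBits.recExpQ F q (affMap a b) n (fun t => (t - affMean a b n s) ^ 2) s
      ≤ (Real.sqrt (sqGainSum a n) * G / 2 + LimitedBits.absGainSum a n * (ε * G)) ^ 2 := by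
  have hε : 0 ≤ ε := (abs_nonneg _).trans (hq 0 le_rfl zero_le_one)
  have hS := sqGainSum_nonneg a n
  refine LimitedBits.le_sq_add_of_forall_young (by positivity)
    (mul_nonneg (LimitedBits.absGainSum_nonneg a n) (mul_nonneg hε hG)) fun r hr => ?_
  have h := LimitedBits.recExpQ_sq_le_general F hq01 hq a b n s hns hgap hr
  have hA2 : (Real.sqrt (sqGainSum a n) * G / 2) ^ 2 = sqGainSum a n * (G ^ 2 / 4) := by
    rw [div_pow, mul_pow, Real.sq_sqrt hS]; ring
  rwa [hA2]

end Summit.Ventures.CertifiedArithmetic.LowPrec.SR
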